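import Summits.CriticalPhenomena.PercolationContinuityZ3.Theorems.PercNearOneGluingNoHeavyQuantLowCrossHeavyLongPoly
import HarnessLib

/-!
# QUANT lane R8, T-DEC, binder (II): the LOW-CROSS PIECE WITH THE LONG CELL HEAVY — part 2, the giant inequality of the corner flow, cell by cell

builds on p205010 (kernel theorem, internal audit signed; external expert review pending)

Support file (`--supports stmt-CriticalPhenomena-4575`), QUANT lane seat prim-quant-arm-2 (gen 31), rung R8 of
`run/shared/lean/prim/quant/LADDER.md`.  Each `tfpCell_LC_*` lemma is the giant-capacity inequality of the corner flow of the low-cross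
piece on one cell (`L*`/`H*`: light/heavy raised pair `(A,B)`; `b`: the mid is exhausted by atom `A`; `a0`: the mid cannot take atom `0`;
`a2`: the mid is shared), in the coordinates `(x, k, g, w = A/B)` with the closed forms of the two usages substituted; proof = certificate of
part 1 + `field_simp; ring`.  Theorems only, standard axioms.

[this work]; DEC rules ARCH-TREES-G49 §2.2 / DEC-TAMP-G50 §3.1, the single-low criterion `…QuantSingleLowCapacity` (typer g23), the
cell-certificate pipeline FOR-PROVERS-CERT-PIPELINE (typer g23), the (II) piece anatomy FOR-PROVERS-CONV-PIECES (lead g26) — this lane.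
Nothing here is cited as a published result.  The gluing rows served [cite: KozmaNitzan2024, Conjecture 3 (p. 15)]; product measure
[cite: Grimmett1999, §1.3 p. 10].
-/

noncomputable section

namespace Summit.CriticalPhenomena.PercolationContinuityZ3.Theorems

namespace Quant

open Finset

namespace LawDec

set_option maxHeartbeats 4000000 in
set_option maxRecDepth 100000 in
/-- cell `LC_LL_b` of the low-cross heavy-long piece: the giant-capacity inequality of the corner flow in closed form. -/
theorem tfpCell_LC_LL_b (x k g w : ℝ) (hx0 : 0 < x) (hx1 : x < 1) (_hk0 : 0 < k) (hkx : k < x) (hxg : x ≤ g) (hg1 : g ≤ 1) (_hw0 : 0 < w) (hw1 : w < 1) (hlow : 2 * w < w * k + g) (hrho : w * k + g - 2 * w ≤ x * (1 - w)) :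
    x / (1 - x) * (((x ^ 2 + (1 - x) * k) * (1 - g)) - ((1 - (x ^ 2 + (1 - x) * k)) * g) * ((1 - x) * ((1 - x) * w + (1 + x) - (w * k + g))) / (x ^ 2 * (1 - w) + (1 - x) * (w * k + g - 2 * w)) + ((1 - (x ^ 2 + (1 - x) * k)) * (1 - g))) ≤
      (x ^ 2 + (1 - x) * k) * g := by
  have h1x : 0 < 1 - x := by linarith
  have g0 : 0 ≤ x := hx0.le
  have g1 : 0 ≤ 1 - x := h1x.le
  have g3 : 0 ≤ x - k := by linarith
  have g4 : 0 ≤ g - x := by linarith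
  have g5 : 0 ≤ 1 - g := by linarith
  have g7 : 0 ≤ 1 - w := by linarith
  have g9 : 0 ≤ x * (1 - w) - (w * k + g - 2 * w) := by linarith
  have key := tfpPoly_LC_LL_b x k g w g0 g1 g3 g4 g5 g7 g9
  have hd0 : 0 < 1 - x := h1x
  have hd1 : 0 < x ^ 2 * (1 - w) + (1 - x) * (w * k + g - 2 * w) := by nlinarith [pow_pos hx0 2, mul_pos (pow_pos hx0 2) (sub_pos.2 hw1)]
  have hne1x : (1:ℝ) - x ≠ 0 := h1x.ne'
  have hNUMpos : 0 < x ^ 2 * (1 - w) + (1 - x) * (w * k + g - 2 * w) := by nlinarith [mul_pos (pow_pos hx0 2) (sub_pos.2 hw1)]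
  have hNUM : x ^ 2 * (1 - w) + (1 - x) * (w * k + g - 2 * w) ≠ 0 := hNUMpos.ne'
  rw [← sub_nonneg]
  have hden : 0 < (1 - x) * (x ^ 2 * (1 - w) + (1 - x) * (w * k + g - 2 * w)) := (mul_pos hd0 hd1)
  have e : ((x ^ 2 + (1 - x) * k) * g - x / (1 - x) * (((x ^ 2 + (1 - x) * k) * (1 - g)) - ((1 - (x ^ 2 + (1 - x) * k)) * g) * ((1 - x) * ((1 - x) * w + (1 + x) - (w * k + g))) / (x ^ 2 * (1 - w) + (1 - x) * (w * k + g - 2 * w)) + ((1 - (x ^ 2 + (1 - x) * k)) * (1 - g)))) * ((1 - x) * (x ^ 2 * (1 - w) + (1 - x) * (w * k + g - 2 * w)))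
      = (x ^ 2 * k ^ 2 * g * w - x ^ 4 * g * w - 2 * x * k ^ 2 * g * w - 3 * x ^ 2 * k * g * w + x ^ 2 * k * g ^ 2 + 3 * x ^ 3 * g * w - x ^ 3 * g ^ 2 - x ^ 3 * k * g + x ^ 4 * g + k ^ 2 * g * w + 5 * x * k * g * w - 2 * x * k * g ^ 2 - 2 * x ^ 2 * g * w + x ^ 2 * g ^ 2 + x ^ 2 * k * w + 2 * x ^ 2 * k * g + x ^ 3 * w - x ^ 3 * g - 2 * k * g * w + k * g ^ 2 - x * g * w - x * k * w - x * k * g - 2 * x ^ 2 * w + x ^ 2 * g - x ^ 3 + 2 * x * w) := by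
    set N0 : ℝ := w * k + g with hN0def
    set N1 : ℝ := x ^ 2 * (1 - w) + (1 - x) * (N0 - 2 * w) with hN1def
    set D1 : ℝ := (1 - x) * ((1 - x) * w + (1 + x) - N0) with hD1def
    field_simp
    rw [hN1def, hD1def]
    rw [hN0def]
    ring
  rw [eq_div_of_mul_eq hden.ne' e]
  apply div_nonneg _ hden.le
  exact key

set_option maxHeartbeats 4000000 in
set_option maxRecDepth 100000 in
/-- cell `LC_LL_a0` of the low-cross heavy-long piece: the giant-capacity inequality of the corner flow in closed form. -/
theorem tfpCell_LC_LL_a0 (x k g w : ℝ) (hx0 : 0 < x) (hx1 : x < 1) (hk0 : 0 < k) (hkx : k < x) (hxg : x ≤ g) (hg1 : g ≤ 1) (hw0 : 0 < w) (_hw1 : w < 1) (hlow : 2 * w < w * k + g) (_hrho : w * k + g - 2 * w ≤ x * (1 - w)) (hsig : 1 ≤ w * k + g) :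
    x / (1 - x) * ((1 - (x ^ 2 + (1 - x) * k)) * (1 - g)) ≤
      (x ^ 2 + (1 - x) * k) * g := by
  have h1x : 0 < 1 - x := by linarith
  have g0 : 0 ≤ x := hx0.le
  have g1 : 0 ≤ 1 - x := h1x.le
  have g2 : 0 ≤ k := hk0.le
  have g3 : 0 ≤ x - k := by linarith
  have g4 : 0 ≤ g - x := by linarith
  have g5 : 0 ≤ 1 - g := by linarith
  have g6 : 0 ≤ w := hw0.le
  have g8 : 0 ≤ w * k + g - 2 * w := by linarith
  have g10 : 0 ≤ w * k + g - 1 := by linarith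
  have key := tfpPoly_LC_LL_a0 x k g w g0 g1 g2 g3 g4 g5 g6 g8 g10
  have hne1x : (1:ℝ) - x ≠ 0 := h1x.ne'
  rw [← sub_nonneg]
  have e : (x ^ 2 + (1 - x) * k) * g - x / (1 - x) * ((1 - (x ^ 2 + (1 - x) * k)) * (1 - g))
      = (-2 * x * k * g + 2 * x ^ 2 * g + k * g + x * g + x * k - x ^ 2 - x) := by
    field_simp
    ring
  rw [e]
  exact key

set_option maxHeartbeats 4000000 in
set_option maxRecDepth 100000 in
/-- cell `LC_LL_a2` of the low-cross heavy-long piece: the giant-capacity inequality of the corner flow in closed form. -/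
theorem tfpCell_LC_LL_a2 (x k g w : ℝ) (hx0 : 0 < x) (hx1 : x < 1) (hk0 : 0 < k) (hkx : k < x) (hxg : x ≤ g) (hg1 : g ≤ 1) (hw0 : 0 < w) (_hw1 : w < 1) (hlow : 2 * w < w * k + g) (hrho : w * k + g - 2 * w ≤ x * (1 - w)) (hsig : w * k + g < 1) :
    x / (1 - x) * (((1 - (x ^ 2 + (1 - x) * k)) * (1 - g)) - (((1 - (x ^ 2 + (1 - x) * k)) * g) * ((1 - x) * ((1 - x) * w + (1 + x) - (w * k + g))) - (x ^ 2 * (1 - w) + (1 - x) * (w * k + g - 2 * w)) * ((x ^ 2 + (1 - x) * k) * (1 - g))) * (1 - w * k - g) / (((1 - x) * ((1 - x) * w + (1 + x) - (w * k + g))) * (w * k + g))) ≤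
      (x ^ 2 + (1 - x) * k) * g := by
  have h1x : 0 < 1 - x := by linarith
  have g0 : 0 ≤ x := hx0.le
  have g1 : 0 ≤ 1 - x := h1x.le
  have g2 : 0 ≤ k := hk0.le
  have g3 : 0 ≤ x - k := by linarith
  have g4 : 0 ≤ g - x := by linarith
  have g5 : 0 ≤ 1 - g := by linarith
  have g6 : 0 ≤ w := hw0.le
  have g7 : 0 ≤ 1 - w := by linarith
  have g8 : 0 ≤ w * k + g - 2 * w := by linarith
  have g9 : 0 ≤ x * (1 - w) - (w * k + g - 2 * w) := by linarith
  have g10 : 0 ≤ 1 - w * k - g := by linarith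
  have key := tfpPoly_LC_LL_a2 x k g w g0 g1 g2 g3 g4 g5 g6 g7 g8 g9 g10
  have hd0 : 0 < w * k + g := by nlinarith
  have hd1 : 0 < (1 - x) * w + (1 + x) - (w * k + g) := by nlinarith
  have hd2 : 0 < 1 - x := h1x
  have hne1x : (1:ℝ) - x ≠ 0 := h1x.ne'
  have hDENin : 0 < (1 - x) * w + (1 + x) - (w * k + g) := by nlinarith [mul_pos hw0 hk0, mul_pos hw0 hx0]
  have hDENpos : 0 < (1 - x) * ((1 - x) * w + (1 + x) - (w * k + g)) := mul_pos h1x hDENin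
  have hDEN : (1 - x) * ((1 - x) * w + (1 + x) - (w * k + g)) ≠ 0 := hDENpos.ne'
  have hN0pos : 0 < w * k + g := by nlinarith [mul_pos hw0 hk0]
  have hN0 : w * k + g ≠ 0 := hN0pos.ne'
  have hDN0 : ((1 - x) * ((1 - x) * w + (1 + x) - (w * k + g))) * (w * k + g) ≠ 0 := mul_ne_zero hDEN hN0
  rw [← sub_nonneg]
  have hden : 0 < (w * k + g) * ((1 - x) * w + (1 + x) - (w * k + g)) * (1 - x) ^ 2 := (mul_pos (mul_pos hd0 hd1) (pow_pos hd2 2))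
  have e : ((x ^ 2 + (1 - x) * k) * g - x / (1 - x) * (((1 - (x ^ 2 + (1 - x) * k)) * (1 - g)) - (((1 - (x ^ 2 + (1 - x) * k)) * g) * ((1 - x) * ((1 - x) * w + (1 + x) - (w * k + g))) - (x ^ 2 * (1 - w) + (1 - x) * (w * k + g - 2 * w)) * ((x ^ 2 + (1 - x) * k) * (1 - g))) * (1 - w * k - g) / (((1 - x) * ((1 - x) * w + (1 + x) - (w * k + g))) * (w * k + g)))) * ((w * k + g) * ((1 - x) * w + (1 + x) - (w * k + g)) * (1 - x) ^ 2)
      = (-x ^ 2 * k ^ 3 * g * w ^ 2 + x ^ 4 * k * g * w ^ 2 + 2 * x * k ^ 3 * g * w ^ 2 + x ^ 2 * k ^ 2 * g * w ^ 2 - 2 * x ^ 2 * k ^ 2 * g ^ 2 * w - x ^ 3 * k * g * w ^ 2 + x ^ 3 * k * g ^ 2 * w + 3 * x ^ 3 * k ^ 2 * g * w + x ^ 4 * g ^ 2 * w - x ^ 4 * k * g * w - 2 * x ^ 5 * g * w - k ^ 3 * g * w ^ 2 - 2 * x * k ^ 2 * g * w ^ 2 + 4 * x * k ^ 2 * g ^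 2 * w + x ^ 2 * k * g * w ^ 2 - x ^ 2 * k * g ^ 3 - 4 * x ^ 2 * k ^ 2 * g * w - x ^ 3 * g ^ 2 * w + x ^ 3 * g ^ 3 - 2 * x ^ 3 * k * w ^ 2 - 5 * x ^ 3 * k * g * w + 3 * x ^ 3 * k * g ^ 2 - x ^ 3 * k ^ 2 * w + 4 * x ^ 4 * g * w - 3 * x ^ 4 * g ^ 2 - 2 * x ^ 4 * k * g + x ^ 5 * w + 2 * x ^ 5 * g + k ^ 2 * g * w ^ 2 - 2 * k ^ 2 * g ^ 2 * w - 2 * x * k * g ^ 2 * w + 2 * x * k * g ^ 3 + x ^ 2 * g ^ 2 * w - x ^ 2 * g ^ 3 + 2 * x ^ 2 * k * w ^ 2 + 8 * x ^ 2 * k * g * w - 4 * x ^ 2 * k * g ^ 2 + x ^ 2 * k ^ 2 * w - 4 * x ^ 3 * g * w + x ^ 3 * g ^ 2 + 4 * x ^ 3 * k * w + x ^ 3 * k * g - 2 * x ^ 4 * w + x ^ 4 * g + x ^ 4 * k - x ^ 5 + k * g ^ 2 * w - k * g ^ 3 + k ^ 2 * g * w - x * k * w ^ 2 - 3 * x *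 k * g * w + x ^ 2 * g ^ 2 - 4 * x ^ 2 * k * w + 2 * x ^ 2 * k * g + 2 * x ^ 3 * w - x ^ 3 * g - x ^ 3 * k + k * g ^ 2 + x * k * w - x * k * g) := by
    set N0 : ℝ := w * k + g with hN0def
    set N1 : ℝ := x ^ 2 * (1 - w) + (1 - x) * (N0 - 2 * w) with hN1def
    set D1 : ℝ := (1 - x) * ((1 - x) * w + (1 + x) - N0) with hD1def
    field_simp
    rw [hN1def, hD1def]
    rw [hN0def]
    ring
  rw [eq_div_of_mul_eq hden.ne' e]
  apply div_nonneg _ hden.le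
  exact key

set_option maxHeartbeats 4000000 in
set_option maxRecDepth 100000 in
/-- cell `LC_LH_b` of the low-cross heavy-long piece: the giant-capacity inequality of the corner flow in closed form. -/
theorem tfpCell_LC_LH_b (x k g w : ℝ) (hx0 : 0 < x) (hx1 : x < 1) (hk0 : 0 < k) (hkx : k < x) (hxg : x ≤ g) (hg1 : g ≤ 1) (hw0 : 0 < w) (_hw1 : w < 1) (hlow : 2 * w < w * k + g) (hrho : x * (1 - w) ≤ w * k + g - 2 * w) :
    x / (1 - x) * (((x ^ 2 + (1 - x) * k) * (1 - g)) - ((1 - (x ^ 2 + (1 - x) * k)) * g) * (w + 1 - w * k - g) / (w * k + g - 2 * w) + ((1 - (x ^ 2 + (1 - x) * k)) * (1 - g))) ≤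
      (x ^ 2 + (1 - x) * k) * g := by
  have h1x : 0 < 1 - x := by linarith
  have g0 : 0 ≤ x := hx0.le
  have g1 : 0 ≤ 1 - x := h1x.le
  have g2 : 0 ≤ k := hk0.le
  have g3 : 0 ≤ x - k := by linarith
  have g4 : 0 ≤ g - x := by linarith
  have g5 : 0 ≤ 1 - g := by linarith
  have g6 : 0 ≤ w := hw0.le
  have g8 : 0 ≤ w * k + g - 2 * w := by linarith
  have g9 : 0 ≤ (w * k + g - 2 * w) - x * (1 - w) := by linarith
  have key := tfpPoly_LC_LH_b x k g w g0 g1 g2 g3 g4 g5 g6 g8 g9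
  have hd0 : 0 < w * k + g - 2 * w := by linarith
  have hd1 : 0 < 1 - x := h1x
  have hne1x : (1:ℝ) - x ≠ 0 := h1x.ne'
  have hNUMpos : 0 < w * k + g - 2 * w := by linarith
  have hNUM : w * k + g - 2 * w ≠ 0 := hNUMpos.ne'
  rw [← sub_nonneg]
  have hden : 0 < (w * k + g - 2 * w) * (1 - x) := (mul_pos hd0 hd1)
  have e : ((x ^ 2 + (1 - x) * k) * g - x / (1 - x) * (((x ^ 2 + (1 - x) * k) * (1 - g)) - ((1 - (x ^ 2 + (1 - x) * k)) * g) * (w + 1 - w * k - g) / (w * k + g - 2 * w) + ((1 - (x ^ 2 + (1 - x) * k)) * (1 - g)))) * ((w * k + g - 2 * w) * (1 - x))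
      = (-x * k ^ 2 * g * w + x ^ 3 * g * w + k ^ 2 * g * w + 3 * x * k * g * w - x * k * g ^ 2 - 2 * x ^ 2 * g * w + x ^ 2 * g ^ 2 + x ^ 2 * k * g - x ^ 3 * g - 2 * k * g * w + k * g ^ 2 - x * g * w - x * k * w - x * k * g + 2 * x * w) := by
    set N0 : ℝ := w * k + g with hN0def
    set N1 : ℝ := (N0 - 2 * w) with hN1def
    set D1 : ℝ := (w + 1 - w * k - g) with hD1def
    field_simp
    rw [hN1def, hD1def]
    rw [hN0def]
    ring
  rw [eq_div_of_mul_eq hden.ne' e]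
  apply div_nonneg _ hden.le
  exact key

set_option maxHeartbeats 4000000 in
set_option maxRecDepth 100000 in
/-- cell `LC_LH_a0` of the low-cross heavy-long piece: the giant-capacity inequality of the corner flow in closed form. -/
theorem tfpCell_LC_LH_a0 (x k g w : ℝ) (hx0 : 0 < x) (hx1 : x < 1) (hk0 : 0 < k) (hkx : k < x) (hxg : x ≤ g) (hg1 : g ≤ 1) (hw0 : 0 < w) (_hw1 : w < 1) (hlow : 2 * w < w * k + g) (_hrho : x * (1 - w) ≤ w * k + g - 2 * w) (hsig : 1 ≤ w * k + g) :
    x / (1 - x) * ((1 - (x ^ 2 + (1 - x) * k)) * (1 - g)) ≤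
      (x ^ 2 + (1 - x) * k) * g := by
  have h1x : 0 < 1 - x := by linarith
  have g0 : 0 ≤ x := hx0.le
  have g1 : 0 ≤ 1 - x := h1x.le
  have g2 : 0 ≤ k := hk0.le
  have g3 : 0 ≤ x - k := by linarith
  have g4 : 0 ≤ g - x := by linarith
  have g5 : 0 ≤ 1 - g := by linarith
  have g6 : 0 ≤ w := hw0.le
  have g8 : 0 ≤ w * k + g - 2 * w := by linarith
  have g10 : 0 ≤ w * k + g - 1 := by linarith
  have key := tfpPoly_LC_LH_a0 x k g w g0 g1 g2 g3 g4 g5 g6 g8 g10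
  have hne1x : (1:ℝ) - x ≠ 0 := h1x.ne'
  rw [← sub_nonneg]
  have e : (x ^ 2 + (1 - x) * k) * g - x / (1 - x) * ((1 - (x ^ 2 + (1 - x) * k)) * (1 - g))
      = (-2 * x * k * g + 2 * x ^ 2 * g + k * g + x * g + x * k - x ^ 2 - x) := by
    field_simp
    ring
  rw [e]
  exact key

set_option maxHeartbeats 4000000 in
set_option maxRecDepth 100000 in
/-- cell `LC_LH_a2` of the low-cross heavy-long piece: the giant-capacity inequality of the corner flow in closed form. -/
theorem tfpCell_LC_LH_a2 (x k g w : ℝ) (hx0 : 0 < x) (hx1 : x < 1) (hk0 : 0 < k) (hkx : k < x) (hxg : x ≤ g) (hg1 : g ≤ 1) (hw0 : 0 < w) (_hw1 : w < 1) (hlow : 2 * w < w * k + g) (_hrho : x * (1 - w) ≤ w * k + g - 2 * w) (hsig : w * k + g < 1) :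
    x / (1 - x) * (((1 - (x ^ 2 + (1 - x) * k)) * (1 - g)) - (((1 - (x ^ 2 + (1 - x) * k)) * g) * (w + 1 - w * k - g) - (w * k + g - 2 * w) * ((x ^ 2 + (1 - x) * k) * (1 - g))) * (1 - w * k - g) / ((w + 1 - w * k - g) * (w * k + g))) ≤
      (x ^ 2 + (1 - x) * k) * g := by
  have h1x : 0 < 1 - x := by linarith
  have g0 : 0 ≤ x := hx0.le
  have g1 : 0 ≤ 1 - x := h1x.le
  have g2 : 0 ≤ k := hk0.le
  have g3 : 0 ≤ x - k := by linarith
  have g4 : 0 ≤ g - x := by linarith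
  have g5 : 0 ≤ 1 - g := by linarith
  have g6 : 0 ≤ w := hw0.le
  have g7 : 0 ≤ 1 - w := by linarith
  have g8 : 0 ≤ w * k + g - 2 * w := by linarith
  have g10 : 0 ≤ 1 - w * k - g := by linarith
  have key := tfpPoly_LC_LH_a2 x k g w g0 g1 g2 g3 g4 g5 g6 g7 g8 g10
  have hd0 : 0 < w + 1 - w * k - g := by nlinarith
  have hd1 : 0 < w * k + g := by nlinarith
  have hd2 : 0 < 1 - x := h1x
  have hne1x : (1:ℝ) - x ≠ 0 := h1x.ne'
  have hDENpos : 0 < w + 1 - w * k - g := by nlinarith [mul_pos hw0 (sub_pos.2 (lt_trans hkx hx1))]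
  have hDEN : w + 1 - w * k - g ≠ 0 := hDENpos.ne'
  have hN0pos : 0 < w * k + g := by nlinarith [mul_pos hw0 hk0]
  have hN0 : w * k + g ≠ 0 := hN0pos.ne'
  have hDN0 : (w + 1 - w * k - g) * (w * k + g) ≠ 0 := mul_ne_zero hDEN hN0
  rw [← sub_nonneg]
  have hden : 0 < (w + 1 - w * k - g) * (w * k + g) * (1 - x) := (mul_pos (mul_pos hd0 hd1) hd2)
  have e : ((x ^ 2 + (1 - x) * k) * g - x / (1 - x) * (((1 - (x ^ 2 + (1 - x) * k)) * (1 - g)) - (((1 - (x ^ 2 + (1 - x) * k)) * g) * (w + 1 - w * k - g) - (w * k + g - 2 * w) * ((x ^ 2 + (1 - x) * k) * (1 - g))) * (1 - w * k - g) / ((w + 1 - w * k - g) * (w * k + g)))) * ((w + 1 - w * k - g) * (w * k + g) * (1 - x))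
      = (x * k ^ 3 * g * w ^ 2 - 2 * x ^ 2 * k ^ 2 * g * w ^ 2 + x ^ 3 * k * g * w ^ 2 - k ^ 3 * g * w ^ 2 + 2 * x * k ^ 2 * g ^ 2 * w + x ^ 2 * k * g * w ^ 2 - 3 * x ^ 2 * k * g ^ 2 * w + x ^ 2 * k ^ 2 * w ^ 2 - x ^ 2 * k ^ 2 * g * w + x ^ 3 * g ^ 2 * w - x ^ 3 * k * w ^ 2 + x ^ 3 * k * g * w + k ^ 2 * g * w ^ 2 - 2 * k ^ 2 * g ^ 2 * w + x * k * g ^ 3 + x ^ 2 * g ^ 2 * w - x ^ 2 * g ^ 3 + 5 * x ^ 2 * k * g * w - x ^ 2 * k * g ^ 2 - 4 * x ^ 3 * g * w + x ^ 3 * g ^ 2 + k * g ^ 2 * w - k * g ^ 3 + k ^ 2 * g * w - x * k * w ^ 2 - 3 * x * k * g * w + x ^ 2 * g ^ 2 - 2 * x ^ 2 * k * w + x ^ 2 * k * g + 2 * x ^ 3 * w - x ^ 3 * g + k * g ^ 2 + x * k * w - x * k * g) := by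
    set N0 : ℝ := w * k + g with hN0def
    set N1 : ℝ := (N0 - 2 * w) with hN1def
    set D1 : ℝ := (w + 1 - w * k - g) with hD1def
    field_simp
    rw [hN1def, hD1def]
    rw [hN0def]
    ring
  rw [eq_div_of_mul_eq hden.ne' e]
  apply div_nonneg _ hden.le
  exact key

end LawDec

end Quant

end Summit.CriticalPhenomena.PercolationContinuityZ3.Theorems
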